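import Literature.Computability.QuantumComplexity.GaussCodeFP
import Literature.Computability.QuantumComplexity.CliffordTSymbolicPaths
import Literature.Computability.QuantumComplexity.BravyiGossetPairData
import Literature.Computability.QuantumComplexity.StabilizerSimulation
import HarnessLib
/-!
# The Bravyi–Gosset estimator on codes, II: instance tuples and symbolic execution

Topic `Literature/Computability/QuantumComplexity`, sub-namespace `BravyiGosset`, machine side of
the discharge of `BravyiGosset2016_estimateAcceptProb` (continued from `GaussCodeFP.lean`).
The input code `CliffordTInstance.encode i` is identified with the typed code of an
**instance tuple** `((n, m, gate codes), (input bits, q))` (`encode_eq_itE`), a gate code being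
`(tag, symbol, wires)` as written by `QGate.encode`; the symbolic execution of
`CliffordTSymbolicPaths.lean` (`SymState.init/step/exec`) is then a left fold over the gate codes
(`execGates_eq_finalT`), computed on codes by a polynomial-time string function
(`finalT_codeFP`) — typed `CodeFP` facts, no machine is written. The shape invariant
`SymState.Shaped` (every form mentions fewer than `nv` variables, the phase data are sized) bounds
the state code polynomially along the fold.

## References

* S. Arora, B. Barak, *Computational Complexity: A Modern Approach*, CUP 2009, §1.3, §6.1
  (descriptions of circuits).
* S. Bravyi, D. Gosset, *Improved classical simulation of quantum circuits dominated by Clifford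
  gates*, Phys. Rev. Lett. 116 (2016) 250501, §II (the Clifford part is tracked symbolically).
-/

namespace Literature.Computability.QuantumComplexity.BravyiGosset

open _root_.Computability Literature.Computability.Complexity Literature.Computability.Complexity.CodeFP
  Literature.Computability.Cryptography

/-! ### Gate codes and instance tuples -/

/-- A gate code: tag (`1` = oracle query), symbol number (or the number of query wires), wires.
[cite: AroraBarak2009, §6.1] -/
abbrev GateCode : Type := Bool × ℕ × List ℕ

/-- The string of a gate code, as written by `QGate.encode`: the tag, then the pair of the binary
symbol and the (length-headed) wire list. [cite: AroraBarak2009, §6.1] -/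
def gcE : GateCode → List Bool := fun t => t.1 :: pairE natE (listE natE) t.2

/-- The gate code of a placed gate. [folklore] -/
noncomputable def gateTriple {N : ℕ} : QGate cliffordT N → GateCode
  | .gate g e => (false, Encodable.encode g, List.ofFn fun i => (e i : ℕ))
  | .oracle k e => (true, k, List.ofFn fun i => (e i : ℕ))

/-- The tree's list-of-naturals encoding is `listE natE`. [folklore] -/
theorem encodingListNatBool_encode_eq : (encodingListNatBool.encode : List ℕ → List Bool) = listE natE := by
  rw [show encodingListNatBool = encodingNatBool.listBool from rfl, listE_eq, natE_eq]

/-- `QGate.encode` writes the gate code. [folklore] -/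
theorem encode_eq_gcE {N : ℕ} (g : QGate cliffordT N) : g.encode = gcE (gateTriple g) := by
  cases g with
  | gate g e =>
    show false :: boolPair (encodeNat _) (encodingListNatBool.encode _) = _
    rw [encodingListNatBool_encode_eq]; rfl
  | oracle k e =>
    show true :: boolPair (encodeNat _) (encodingListNatBool.encode _) = _
    rw [encodingListNatBool_encode_eq]; rfl

/-- Reading a gate code as a symbolic gate (symbols `0, 1, 2, 3` are `H, S, T, CNOT`).
[folklore] -/
def symOfCode (t : GateCode) : SymGate :=
  if t.1 then .skip
  else if t.2.1 = 0 then .H (t.2.2.getD 0 0)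
  else if t.2.1 = 1 then .S (t.2.2.getD 0 0)
  else if t.2.1 = 2 then .T (t.2.2.getD 0 0)
  else .CX (t.2.2.getD 0 0) (t.2.2.getD 1 0)

/-- The symbolic gate of a gate code is `toSymGate`. [folklore] -/
theorem symOfCode_gateTriple {N : ℕ} (g : QGate cliffordT N) : symOfCode (gateTriple g) = toSymGate g := by
  rcases g with ⟨op, e⟩ | ⟨k, e⟩
  · cases op <;> rfl
  · rfl

/-- Instance tuples: `((n, m, gate codes), (input bits, q))`. [folklore] -/
abbrev IT : Type := (ℕ × ℕ × List GateCode) × (List Bool × ℕ)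

/-- The code of an instance tuple (the layout of `CliffordTInstance.encode`). [folklore] -/
def itE : IT → List Bool := pairE (pairE natE (pairE unE (rawE gcE))) (pairE strE unE)

/-- The instance tuple of an instance. [folklore] -/
noncomputable def instTuple (i : CliffordTInstance) : IT :=
  ((i.n, i.m, i.circ.gates.map gateTriple), (List.ofFn i.x, i.q))

/-- The circuit encoding is the raw list of the gate codes. [folklore] -/
theorem circuit_encode_eq {N : ℕ} (C : QCircuit cliffordT N) : C.encode = rawE gcE (C.gates.map gateTriple) := by
  unfold QCircuit.encode
  induction C.gates with
  | nil => rfl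
  | cons g gs ih => rw [List.foldr_cons, ih, List.map_cons, rawE_cons, encode_eq_gcE]

/-- **The input code is the code of the instance tuple.** [folklore] -/
theorem encode_eq_itE (i : CliffordTInstance) : CliffordTInstance.encode i = itE (instTuple i) := by
  unfold CliffordTInstance.encode instTuple itE
  rw [pairE_apply, pairE_apply, pairE_apply, pairE_apply]
  simp only
  rw [← circuit_encode_eq]
  rfl

/-! ### The symbolic execution as a fold over gate codes -/

/-- The initial symbolic state from the tuple: constant forms `x ++ 0^m`. [folklore] -/
def initT (it : IT) : SymState :=
  ⟨(it.2.1 ++ List.replicate it.1.2.1 false).map AffForm.const, ⟨0, [], []⟩, [], 0⟩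

/-- `SymState.init (x 0^m)` is `initT`. [folklore] -/
theorem init_eq_initT (i : CliffordTInstance) : SymState.init (padInput i.x i.m) = initT (instTuple i) := by
  unfold SymState.init initT padInput
  congr 1
  show List.ofFn (AffForm.const ∘ Fin.append i.x (fun _ => false)) =
    (List.ofFn i.x ++ List.replicate i.m false).map AffForm.const
  rw [← List.map_ofFn, List.ofFn_fin_append, List.ofFn_const]

/-- The final symbolic state from the tuple: fold the steps of the gate codes. [folklore] -/
def finalT (it : IT) : SymState :=
  it.1.2.2.foldl (fun σ gc => SymState.step (symOfCode gc) σ) (initT it)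

/-- **Symbolic execution of the circuit is `finalT` of the instance tuple.** [folklore] -/
theorem execGates_eq_finalT (i : CliffordTInstance) :
    SymState.execGates i.circ.gates (SymState.init (padInput i.x i.m)) = finalT (instTuple i) := by
  rw [init_eq_initT]
  unfold SymState.execGates SymState.exec finalT
  rw [show (instTuple i).1.2.2 = i.circ.gates.map gateTriple from rfl]
  simp only [List.foldl_map, symOfCode_gateTriple]

/-! ### Reading gate codes -/

/-- The tag. [folklore] -/
theorem gcTag : CodeFP gcE bitE (fun t => t.1) := of_fn take1Fn take1Fn_mem_FP fun _ => rfl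

/-- The body `(symbol, wires)`. [folklore] -/
theorem gcBody : CodeFP gcE (pairE natE (listE natE)) (fun t => t.2) :=
  of_fn List.tail PRelSigma.tail_mem_FP fun _ => rfl

/-- The symbol number. [folklore] -/
theorem gcOp : CodeFP gcE natE (fun t => t.2.1) := (fst natE (listE natE)).comp gcBody

/-- The wires as a raw list. [folklore] -/
theorem gcWires : CodeFP gcE (rawE natE) (fun t => t.2.2) :=
  ((rawOfList natE).comp ((snd natE (listE natE)).comp gcBody)).congr fun _ => rfl

/-- Wire `0`. [folklore] -/
theorem gcWire0 : CodeFP gcE natE (fun t => t.2.2.getD 0 0) :=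
  (rawGetOr natE).comp (gcWires.pair ((const gcE (0 : ℕ)).pair (const gcE (0 : ℕ))))

/-- Wire `1`. [folklore] -/
theorem gcWire1 : CodeFP gcE natE (fun t => t.2.2.getD 1 0) :=
  (rawGetOr natE).comp (gcWires.pair ((const gcE (1 : ℕ)).pair (const gcE (0 : ℕ))))

/-! ### Symbolic states on codes -/

/-- Lists of affine forms. [folklore] -/
abbrev formsE : List AffForm → List Bool := rawE affE

/-- The code of a symbolic state: `⟨forms, ⟨D, ⟨tforms, 1^{nv}⟩⟩⟩`. [folklore] -/
def stE : SymState → List Bool := fun σ => pairE formsE (pairE gdE (pairE formsE unE)) (σ.forms, σ.D, σ.tforms, σ.nv)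

/-- The tuple of a state. [folklore] -/
abbrev stTupleE : List AffForm × GData × List AffForm × ℕ → List Bool := pairE formsE (pairE gdE (pairE formsE unE))

/-- The forms. [folklore] -/
theorem stForms : CodeFP stE formsE SymState.forms :=
  (fst _ _).comp (transparent (eα := stE) (eβ := stTupleE) (g := fun σ => (σ.forms, σ.D, σ.tforms, σ.nv)) fun _ => rfl)

/-- The phase data. [folklore] -/
theorem stD : CodeFP stE gdE SymState.D :=
  (snd _ _).fst'.comp (transparent (eα := stE) (eβ := stTupleE) (g := fun σ => (σ.forms, σ.D, σ.tforms, σ.nv)) fun _ => rfl)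

/-- The `T` forms. [folklore] -/
theorem stT : CodeFP stE formsE SymState.tforms :=
  (snd _ _).snd'.fst'.comp (transparent (eα := stE) (eβ := stTupleE) (g := fun σ => (σ.forms, σ.D, σ.tforms, σ.nv)) fun _ => rfl)

/-- The variable counter. [folklore] -/
theorem stNv : CodeFP stE unE SymState.nv :=
  (snd _ _).snd'.snd'.comp (transparent (eα := stE) (eβ := stTupleE) (g := fun σ => (σ.forms, σ.D, σ.tforms, σ.nv)) fun _ => rfl)

/-- Assembling a state. [folklore] -/
theorem stMk : CodeFP stTupleE stE (fun t => (⟨t.1, t.2.1, t.2.2.1, t.2.2.2⟩ : SymState)) :=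
  transparent fun _ => rfl

/-- Reading a wire form (`const 0` beyond the register). [folklore] -/
theorem formAt : CodeFP (pairE stE natE) affE (fun t => t.1.form t.2) := by
  have h : CodeFP (pairE stE natE) affE (fun t => t.1.forms.getD t.2 (AffForm.const false)) := by
    exact ((rawGetOr affE).comp ((stForms.comp (fst stE natE)).pair ((snd stE natE).pair
      (const _ (AffForm.const false)))) :)
  exact h.congr fun _ => rfl

/-- Reading a `T` form. [folklore] -/
theorem tformAt : CodeFP (pairE stE natE) affE (fun t => t.1.tform t.2) := by
  have h : CodeFP (pairE stE natE) affE (fun t => t.1.tforms.getD t.2 (AffForm.const false)) := by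
    exact ((rawGetOr affE).comp ((stT.comp (fst stE natE)).pair ((snd stE natE).pair
      (const _ (AffForm.const false)))) :)
  exact h.congr fun _ => rfl

/-- The `H` step on wire `j`. [cite: BravyiGosset2016, §II] -/
theorem stepH_codeFP : CodeFP (pairE stE natE) stE (fun t => SymState.step (.H t.2) t.1) := by
  have hσ : CodeFP (pairE stE natE) stE (fun t => t.1) := fst stE natE
  have hj : CodeFP (pairE stE natE) natE (fun t => t.2) := snd stE natE
  have hu : CodeFP (pairE stE natE) affE (fun t => AffForm.unit t.1.nv) := affUnit.comp (stNv.comp hσ)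
  have hforms : CodeFP (pairE stE natE) formsE (fun t => t.1.forms.set t.2 (AffForm.unit t.1.nv)) := by
    exact ((setAt affE).comp ((stForms.comp hσ).pair (hj.pair hu)) :)
  have hD : CodeFP (pairE stE natE) gdE (fun t => GData.addQuadProduct (t.1.form t.2) (AffForm.unit t.1.nv) t.1.D) := by
    exact (addQuadProduct_codeFP.comp (formAt.pair (hu.pair (stD.comp hσ))) :)
  have hnv : CodeFP (pairE stE natE) unE (fun t => t.1.nv + 1) := unSucc.comp (stNv.comp hσ)
  exact (stMk.comp (hforms.pair (hD.pair ((stT.comp hσ).pair hnv)))).congr fun _ => rfl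

/-- The `S` step on wire `j`. [cite: BravyiGosset2016, §II] -/
theorem stepS_codeFP : CodeFP (pairE stE natE) stE (fun t => SymState.step (.S t.2) t.1) := by
  have hσ : CodeFP (pairE stE natE) stE (fun t => t.1) := fst stE natE
  have hD : CodeFP (pairE stE natE) gdE (fun t => GData.addPhaseForm 1 (t.1.form t.2) t.1.D) := by
    exact (addPhaseForm_codeFP.comp ((const _ (1 : ℕ)).pair (formAt.pair (stD.comp hσ))) :)
  exact (stMk.comp ((stForms.comp hσ).pair (hD.pair ((stT.comp hσ).pair (stNv.comp hσ))))).congr fun _ => rfl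

/-- The `T` step on wire `j`. [cite: BravyiGosset2016, §II] -/
theorem stepT_codeFP : CodeFP (pairE stE natE) stE (fun t => SymState.step (.T t.2) t.1) := by
  have hσ : CodeFP (pairE stE natE) stE (fun t => t.1) := fst stE natE
  have ht : CodeFP (pairE stE natE) formsE (fun t => t.1.tforms ++ [t.1.form t.2]) := by
    exact ((rawAppend affE).comp ((stT.comp hσ).pair ((rawSingleton affE).comp formAt)) :)
  exact (stMk.comp ((stForms.comp hσ).pair ((stD.comp hσ).pair (ht.pair (stNv.comp hσ))))).congr fun _ => rfl

/-- The `CNOT` step with control `c` and target `d`. [cite: BravyiGosset2016, §II] -/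
theorem stepCX_codeFP : CodeFP (pairE stE (pairE natE natE)) stE (fun t => SymState.step (.CX t.2.1 t.2.2) t.1) := by
  have hσ : CodeFP (pairE stE (pairE natE natE)) stE (fun t => t.1) := fst stE (pairE natE natE)
  have hc : CodeFP (pairE stE (pairE natE natE)) natE (fun t => t.2.1) := (snd stE (pairE natE natE)).fst'
  have hd : CodeFP (pairE stE (pairE natE natE)) natE (fun t => t.2.2) := (snd stE (pairE natE natE)).snd'
  have hfc : CodeFP (pairE stE (pairE natE natE)) affE (fun t => t.1.form t.2.1) := formAt.comp (hσ.pair hc)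
  have hfd : CodeFP (pairE stE (pairE natE natE)) affE (fun t => t.1.form t.2.2) := formAt.comp (hσ.pair hd)
  have hnew : CodeFP (pairE stE (pairE natE natE)) affE (fun t => (t.1.form t.2.2).add (t.1.form t.2.1)) :=
    affAdd.comp (hfd.pair hfc)
  have hforms : CodeFP (pairE stE (pairE natE natE)) formsE (fun t => t.1.forms.set t.2.2 ((t.1.form t.2.2).add (t.1.form t.2.1))) := by
    exact ((setAt affE).comp ((stForms.comp hσ).pair (hd.pair hnew)) :)
  exact (stMk.comp (hforms.pair ((stD.comp hσ).pair ((stT.comp hσ).pair (stNv.comp hσ))))).congr fun _ => rfl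

/-- **One symbolic step from a gate code.** [cite: BravyiGosset2016, §II] -/
theorem stepCode_codeFP : CodeFP (pairE stE gcE) stE (fun t => SymState.step (symOfCode t.2) t.1) := by
  have hσ : CodeFP (pairE stE gcE) stE (fun t => t.1) := fst stE gcE
  have hg : CodeFP (pairE stE gcE) gcE (fun t => t.2) := snd stE gcE
  have htag : CodeFP (pairE stE gcE) bitE (fun t => t.2.1) := gcTag.comp hg
  have hop : CodeFP (pairE stE gcE) natE (fun t => t.2.2.1) := gcOp.comp hg
  have hw0 : CodeFP (pairE stE gcE) natE (fun t => t.2.2.2.getD 0 0) := gcWire0.comp hg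
  have hw1 : CodeFP (pairE stE gcE) natE (fun t => t.2.2.2.getD 1 0) := gcWire1.comp hg
  have his : ∀ c : ℕ, CodeFP (pairE stE gcE) bitE (fun t => decide (t.2.2.1 = c)) := fun c =>
    natEq.comp (hop.pair (const _ c))
  have hH : CodeFP (pairE stE gcE) stE (fun t => SymState.step (.H (t.2.2.2.getD 0 0)) t.1) := stepH_codeFP.comp (hσ.pair hw0)
  have hS : CodeFP (pairE stE gcE) stE (fun t => SymState.step (.S (t.2.2.2.getD 0 0)) t.1) := stepS_codeFP.comp (hσ.pair hw0)
  have hT : CodeFP (pairE stE gcE) stE (fun t => SymState.step (.T (t.2.2.2.getD 0 0)) t.1) := stepT_codeFP.comp (hσ.pair hw0)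
  have hC : CodeFP (pairE stE gcE) stE (fun t => SymState.step (.CX (t.2.2.2.getD 0 0) (t.2.2.2.getD 1 0)) t.1) :=
    stepCX_codeFP.comp (hσ.pair (hw0.pair hw1))
  refine (htag.ite hσ ((his 0).ite hH ((his 1).ite hS ((his 2).ite hT hC)))).congr fun t => ?_
  obtain ⟨σ, tag, c, ws⟩ := t
  simp only [symOfCode]
  cases tag
  · simp only [Bool.false_eq_true, if_false]
    by_cases h0 : c = 0
    · simp [h0]
    by_cases h1 : c = 1
    · simp [h1]
    by_cases h2 : c = 2
    · simp [h2]
    simp [h0, h1, h2]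
  · simp; rfl

/-! ### The shape invariant of symbolic execution -/

namespace SymState

/-- **Shapes**: `N` wire forms, every form (wire or `T`) has at most `nv` coefficients, the phase
data are sized by `nv`, and `nv`, the number of `T` forms are at most `G`. [folklore] -/
def Shaped (N G : ℕ) (σ : SymState) : Prop :=
  σ.forms.length = N ∧ (∀ f ∈ σ.forms, f.a.length ≤ σ.nv) ∧ (∀ f ∈ σ.tforms, f.a.length ≤ σ.nv) ∧
    σ.D.Sized σ.nv ∧ σ.nv ≤ G ∧ σ.tforms.length ≤ G

/-- The length of a read form. [folklore] -/
theorem length_form_le {σ : SymState} {K : ℕ} (h : ∀ f ∈ σ.forms, f.a.length ≤ K) (j : ℕ) :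
    (σ.form j).a.length ≤ K := by
  unfold SymState.form
  rw [List.getD_eq_getElem?_getD]
  cases hj : σ.forms[j]? with
  | none => simp [AffForm.const]
  | some f => simpa using h f (List.mem_of_getElem? hj)

end SymState

/-- `Sized` is monotone in the bound. [folklore] -/
theorem GData.Sized.mono {K K' : ℕ} {D : GData} (h : D.Sized K) (hK : K ≤ K') : D.Sized K' := by
  obtain ⟨h1, h2, h3, h4, h5⟩ := h
  exact ⟨h1, h2.trans hK, h3, h4.trans hK, fun row hr => (h5 row hr).trans hK⟩

/-- Lengths after `List.set`. [folklore] -/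
theorem forall_mem_set {l : List AffForm} {K : ℕ} (h : ∀ f ∈ l, f.a.length ≤ K) (j : ℕ) {g : AffForm}
    (hg : g.a.length ≤ K) : ∀ f ∈ l.set j g, f.a.length ≤ K := by
  intro f hf
  rcases List.mem_or_eq_of_mem_set hf with h' | rfl
  · exact h f h'
  · exact hg

namespace SymState

/-- **One step keeps shapes** (with one more gate allowed). [folklore] -/
theorem Shaped.step {N G : ℕ} {σ : SymState} (h : σ.Shaped N G) (g : SymGate) : (SymState.step g σ).Shaped N (G + 1) := by
  obtain ⟨h1, h2, h3, h4, h5, h6⟩ := h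
  have hform : ∀ j, (σ.form j).a.length ≤ σ.nv := length_form_le h2
  cases g with
  | H j =>
    have hu : (AffForm.unit σ.nv).a.length ≤ σ.nv + 1 := by simp [AffForm.unit]
    refine ⟨by simp [SymState.step, h1], ?_, ?_, ?_, ?_, ?_⟩
    · show ∀ f ∈ σ.forms.set j (AffForm.unit σ.nv), f.a.length ≤ σ.nv + 1
      exact forall_mem_set (fun f hf => (h2 f hf).trans (Nat.le_succ _)) j hu
    · show ∀ f ∈ σ.tforms, f.a.length ≤ σ.nv + 1
      exact fun f hf => (h3 f hf).trans (Nat.le_succ _)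
    · show (GData.addQuadProduct (σ.form j) (AffForm.unit σ.nv) σ.D).Sized (σ.nv + 1)
      exact (h4.mono (Nat.le_succ _)).addQuadProduct ((hform j).trans (Nat.le_succ _)) hu
    · show σ.nv + 1 ≤ G + 1
      omega
    · show σ.tforms.length ≤ G + 1
      omega
  | S j =>
    refine ⟨h1, h2, h3, ?_, h5.trans (Nat.le_succ _), h6.trans (Nat.le_succ _)⟩
    show (GData.addPhaseForm 1 (σ.form j) σ.D).Sized σ.nv
    exact h4.addPhaseForm 1 (hform j)
  | T j =>
    refine ⟨h1, h2, ?_, h4, h5.trans (Nat.le_succ _), ?_⟩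
    · show ∀ f ∈ σ.tforms ++ [σ.form j], f.a.length ≤ σ.nv
      intro f hf
      rw [List.mem_append, List.mem_singleton] at hf
      rcases hf with hf | rfl
      · exact h3 f hf
      · exact hform j
    · show (σ.tforms ++ [σ.form j]).length ≤ G + 1
      rw [List.length_append, List.length_singleton]; omega
  | CX c d =>
    refine ⟨by simp [SymState.step, h1], ?_, h3, h4, h5.trans (Nat.le_succ _), h6.trans (Nat.le_succ _)⟩
    show ∀ f ∈ σ.forms.set d ((σ.form d).add (σ.form c)), f.a.length ≤ σ.nv
    refine forall_mem_set h2 d ?_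
    show (AffForm.bxor (σ.form d).a (σ.form c).a).length ≤ σ.nv
    rw [AffForm.length_bxor]; exact max_le (hform d) (hform c)
  | skip => exact ⟨h1, h2, h3, h4, h5.trans (Nat.le_succ _), h6.trans (Nat.le_succ _)⟩

/-- Shapes along a fold of steps. [folklore] -/
theorem Shaped.foldl {N G : ℕ} {σ : SymState} (h : σ.Shaped N G) (l : List GateCode) :
    (l.foldl (fun σ gc => SymState.step (symOfCode gc) σ) σ).Shaped N (G + l.length) := by
  induction l generalizing σ G with
  | nil => simpa using h
  | cons gc l ih =>
    rw [List.foldl_cons, List.length_cons]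
    have := ih (h.step (symOfCode gc))
    rwa [show G + 1 + l.length = G + (l.length + 1) by omega] at this

/-- The initial state is shaped. [folklore] -/
theorem shaped_initT (it : IT) : (initT it).Shaped (it.2.1.length + it.1.2.1) 0 := by
  refine ⟨by simp [initT], ?_, ?_, ?_, le_rfl, by simp [initT]⟩
  · intro f hf
    simp only [initT, List.mem_map] at hf
    obtain ⟨b, _, rfl⟩ := hf
    simp [AffForm.const]
  · simp [initT]
  · exact ⟨by simp [initT], by simp [initT], by simp [initT], by simp [initT], by simp [initT]⟩

/-! ### The size of a shaped state code -/

/-- The code of a short form. [folklore] -/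
theorem length_affE_le {f : AffForm} {K : ℕ} (h : f.a.length ≤ K) : (affE f).length ≤ 4 * K + 4 := by
  show (boolPair (bitE f.c) (bitsE f.a)).length ≤ _
  rw [length_boolPair]
  have := length_rawE_le_of_forall bitE f.a 1 fun b _ => le_of_eq rfl
  simp only [bitE, List.length_singleton] at this ⊢
  nlinarith

/-- The code of a list of short forms. [folklore] -/
theorem length_formsE_le {l : List AffForm} {K : ℕ} (h : ∀ f ∈ l, f.a.length ≤ K) :
    (formsE l).length ≤ l.length * (8 * K + 10) :=
  length_rawE_le_of_forall affE l (4 * K + 4) (fun f hf => length_affE_le (h f hf)) |>.trans (by nlinarith)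

/-- **A shaped state has a code of size `O((N + G) G²)`.** [folklore] -/
theorem Shaped.length_stE_le {N G : ℕ} {σ : SymState} (h : σ.Shaped N G) :
    (stE σ).length ≤ 160 * (N + G + 1) ^ 3 := by
  obtain ⟨h1, h2, h3, h4, h5, h6⟩ := h
  set S := N + G + 1 with hS
  have hN : N ≤ S := by omega
  have hG : G ≤ S := by omega
  have e1 : (formsE σ.forms).length ≤ S * (8 * S + 10) := by
    have := length_formsE_le (fun f hf => (h2 f hf).trans h5); rw [h1] at this
    exact this.trans (Nat.mul_le_mul hN (by omega))
  have e2 : (gdE σ.D).length ≤ 8 * S ^ 2 + 18 * S + 10 := by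
    have hG2 : G ^ 2 ≤ S ^ 2 := Nat.pow_le_pow_left hG 2
    have := GData.length_gdE_le (h4.mono h5)
    omega
  have e3 : (formsE σ.tforms).length ≤ S * (8 * S + 10) :=
    (length_formsE_le (fun f hf => (h3 f hf).trans h5)).trans (Nat.mul_le_mul (h6.trans hG) (by omega))
  have e4 : (unE σ.nv).length ≤ S := by rw [length_unE]; exact h5.trans hG
  show (boolPair (formsE σ.forms) (boolPair (gdE σ.D) (boolPair (formsE σ.tforms) (unE σ.nv)))).length ≤ _
  rw [length_boolPair, length_boolPair, length_boolPair]
  have hm : S * (8 * S + 10) = 8 * S ^ 2 + 10 * S := by ring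
  have p1 : S ^ 2 ≤ S ^ 3 := Nat.pow_le_pow_right (by omega) (by norm_num)
  have p2 : S ≤ S ^ 2 := by nlinarith
  have p3 : 1 ≤ S ^ 3 := Nat.one_le_pow _ _ (by omega)
  omega

end SymState

/-! ### The whole symbolic execution on codes -/

/-- Bits of a string as a raw list of bits (cut the string into blocks of length `1`). [folklore] -/
theorem bitsOfStr : CodeFP strE bitsE (fun w => w) := by
  have h := strChunks.comp ((strLength).pair ((const strE (1 : ℕ)).pair (CodeFP.id strE)))
  refine (h.recodeOut (eγ := bitsE) (g' := fun w => w) fun w => ?_)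
  show rawE strE ((List.range w.length).map fun i => (w.drop (i * 1)).take 1) = rawE bitE w
  have : ((List.range w.length).map fun i => (w.drop (i * 1)).take 1) = w.map fun b => [b] := by
    apply List.ext_getElem
    · simp
    · intro j h1 h2
      rw [List.length_map, List.length_range] at h1
      simp only [List.getElem_map, List.getElem_range, Nat.mul_one]
      rw [List.take_one_drop_eq_of_lt_length h1]
      simp
  rw [this]
  show encList ((w.map fun b => [b]).map strE) = encList (w.map bitE)
  congr 1
  rw [List.map_map]
  rfl

/-- `initT` on codes. [folklore] -/
theorem initT_codeFP : CodeFP itE stE initT := by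
  have hx : CodeFP itE strE (fun it => it.2.1) := (snd _ _).fst'
  have hm : CodeFP itE unE (fun it => it.1.2.1) := (fst _ _).snd'.fst'
  have hpad : CodeFP itE bitsE (fun it => it.2.1 ++ List.replicate it.1.2.1 false) := by
    exact ((rawAppend bitE).comp ((bitsOfStr.comp hx).pair ((replicateOf bitE).comp ((const _ false).pair hm))) :)
  have hforms : CodeFP itE formsE (fun it => (it.2.1 ++ List.replicate it.1.2.1 false).map AffForm.const) :=
    (map₀ affConst).comp hpad
  exact (stMk.comp (hforms.pair ((const _ (⟨0, [], []⟩ : GData)).pair ((const _ ([] : List AffForm)).pair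
    (const _ (0 : ℕ)))))).congr fun _ => rfl

/-- **The final symbolic state on codes** (a polynomially bounded fold of `stepCode`).
[cite: AroraBarak2009, §1.3; BravyiGosset2016, §II] -/
theorem finalT_codeFP : CodeFP itE stE finalT := by
  have hstep : CodeFP (pairE itE (pairE gcE stE)) stE (fun t => SymState.step (symOfCode t.2.1) t.2.2) :=
    stepCode_codeFP.comp (((snd itE (pairE gcE stE)).snd').pair ((snd itE (pairE gcE stE)).fst'))
  have h := foldl (σ := IT) (α := GateCode) (β := SymState) (eσ := itE) (eα := gcE) (eβ := stE)
    (step := fun _ gc σ => SymState.step (symOfCode gc) σ) (init := initT) hstep initT_codeFP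
    (160 * (Polynomial.X + 1) ^ 3) (fun it l₁ l₂ => ?_)
  · exact (h.comp ((CodeFP.id itE).pair ((fst _ _).snd'.snd'))).congr fun _ => rfl
  · have hsh := (SymState.shaped_initT it).foldl l₁
    rw [Nat.zero_add] at hsh
    refine hsh.length_stE_le.trans ?_
    simp only [Polynomial.eval_mul, Polynomial.eval_pow, Polynomial.eval_add, Polynomial.eval_X,
      Polynomial.eval_one, Polynomial.eval_ofNat]
    apply Nat.mul_le_mul_left
    apply Nat.pow_le_pow_left
    -- `|x| + m + |l₁| ≤ |code|`
    show it.2.1.length + it.1.2.1 + l₁.length + 1 ≤ (boolPair (itE it) (rawE gcE (l₁ ++ l₂))).length + 1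
    rw [length_boolPair]
    have e1 : it.2.1.length + it.1.2.1 ≤ (itE it).length := by
      show _ ≤ (boolPair (boolPair (natE it.1.1) (boolPair (unE it.1.2.1) (rawE gcE it.1.2.2)))
        (boolPair (strE it.2.1) (unE it.2.2))).length
      rw [length_boolPair, length_boolPair, length_boolPair, length_boolPair, length_unE]
      simp only [strE, id]
      omega
    have e2 := length_le_length_rawE gcE (l₁ ++ l₂)
    rw [List.length_append] at e2
    omega

end Literature.Computability.QuantumComplexity.BravyiGosset
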